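import Summits.Ventures.PercRepro.Induction

/-!
# Quadratic forms of a law under one-edge conditioning: the exact chord identity

For a kernel `A : ι → ι → ℝ` on a finite index set (e.g. the partitions of the marked set) write
`quadSum A x = ∑ s, ∑ t, A s t * x s * x t`.  Since every probability is affine in each single
edge probability (`prob_update`), the law `π` of any finite statistic satisfies
`π_{p[e:=x]} = (1 - x) • π⁰ + x • π¹`, and for such a segment the **exact chord identity** holds:

`quadSum A ((1 - x) • u + x • v) = (1 - x) * quadSum A u + x * quadSum A v
                                    - x * (1 - x) * quadSum A (v - u)`

(`quadSum_chord`; no symmetry of `A` is needed).  Hence a quadratic form of the law is concave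
in `p_e` exactly when `quadSum A (π¹ - π⁰) ≤ 0` (`quadSum_chord_ge_of_nonpos`), the skeleton of
every single-edge induction for quadratic inequalities between cell probabilities.
`lawVec_update` specialises the segment form to the vector of probabilities of a finite family
of events.
-/

open Finset

namespace PercRepro

section Chord

variable {ι : Type*} [Fintype ι]

/-- `quadSum A x = ∑ s, ∑ t, A s t * x s * x t`, the quadratic form of the kernel `A` at the
vector `x`. -/
def quadSum (A : ι → ι → ℝ) (x : ι → ℝ) : ℝ := ∑ s, ∑ t, A s t * x s * x t

/-- The bilinear expansion: `quadSum A (a • u + b • v)` in terms of the four cross sums. -/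
theorem quadSum_smul_add_smul (A : ι → ι → ℝ) (u v : ι → ℝ) (a b : ℝ) :
    quadSum A (a • u + b • v) =
      a * a * quadSum A u + a * b * (∑ s, ∑ t, A s t * u s * v t)
        + b * a * (∑ s, ∑ t, A s t * v s * u t) + b * b * quadSum A v := by
  unfold quadSum
  simp only [Finset.mul_sum, ← Finset.sum_add_distrib]
  refine Finset.sum_congr rfl fun s _ => Finset.sum_congr rfl fun t _ => ?_
  simp only [Pi.add_apply, Pi.smul_apply, smul_eq_mul]
  ring

/-- **Exact chord identity** for a quadratic form along a segment:
`Q((1 - x) u + x v) = (1 - x) Q(u) + x Q(v) - x (1 - x) Q(v - u)`. -/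
theorem quadSum_chord (A : ι → ι → ℝ) (u v : ι → ℝ) (x : ℝ) :
    quadSum A ((1 - x) • u + x • v) =
      (1 - x) * quadSum A u + x * quadSum A v - x * (1 - x) * quadSum A (v - u) := by
  have h1 := quadSum_smul_add_smul A u v (1 - x) x
  have h2 : quadSum A (v - u) = quadSum A ((-1 : ℝ) • u + (1 : ℝ) • v) := by
    congr 1
    funext s
    simp only [Pi.sub_apply, Pi.add_apply, Pi.smul_apply, smul_eq_mul]
    ring
  rw [h1, h2, quadSum_smul_add_smul]
  ring

/-- If the quadratic form is nonpositive on the chord direction, the form is concave along the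
segment: `Q((1 - x) u + x v) ≥ (1 - x) Q(u) + x Q(v)` for `x ∈ [0, 1]`. -/
theorem quadSum_chord_ge_of_nonpos (A : ι → ι → ℝ) (u v : ι → ℝ) {x : ℝ} (h0 : 0 ≤ x)
    (h1 : x ≤ 1) (hQ : quadSum A (v - u) ≤ 0) :
    (1 - x) * quadSum A u + x * quadSum A v ≤ quadSum A ((1 - x) • u + x • v) := by
  rw [quadSum_chord]
  nlinarith [mul_nonneg h0 (sub_nonneg.2 h1)]

/-- Concavity along the segment gives the minimum of the endpoints:
`min (Q u) (Q v) ≤ Q((1 - x) u + x v)` for `x ∈ [0, 1]` when `Q(v - u) ≤ 0`. -/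
theorem min_le_quadSum_of_nonpos (A : ι → ι → ℝ) (u v : ι → ℝ) {x : ℝ} (h0 : 0 ≤ x)
    (h1 : x ≤ 1) (hQ : quadSum A (v - u) ≤ 0) :
    min (quadSum A u) (quadSum A v) ≤ quadSum A ((1 - x) • u + x • v) := by
  refine le_trans ?_ (quadSum_chord_ge_of_nonpos A u v h0 h1 hQ)
  have hu := min_le_left (quadSum A u) (quadSum A v)
  have hv := min_le_right (quadSum A u) (quadSum A v)
  nlinarith [mul_nonneg (sub_nonneg.2 h1) (sub_nonneg.2 hu), mul_nonneg h0 (sub_nonneg.2 hv)]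

/-- The quadratic form at a point mass is the diagonal entry: `quadSum A (e_s) = A s s`. -/
theorem quadSum_single (A : ι → ι → ℝ) [DecidableEq ι] (s : ι) :
    quadSum A (Pi.single s 1) = A s s := by
  unfold quadSum
  rw [Finset.sum_eq_single s]
  · rw [Finset.sum_eq_single s]
    · simp
    · intro t _ hts
      simp [hts]
    · intro h
      exact absurd (Finset.mem_univ s) h
  · intro s' _ hs
    refine Finset.sum_eq_zero fun t _ => ?_
    simp [Pi.single_apply, hs]
  · intro h
    exact absurd (Finset.mem_univ s) h

end Chord

/-! ### The law of a finite family of events is affine in each edge probability -/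

section Law

variable {E : Type*} [Fintype E] [DecidableEq E] {ι : Type*}

/-- The vector of probabilities of a family of events `F : ι → Set (Config E)`. -/
noncomputable def lawVec (p : E → ℝ) (F : ι → Set (Config E)) : ι → ℝ := fun s => prob p (F s)

/-- The law vector is affine in each single edge probability:
`lawVec p[e:=x] F = (1 - x) • lawVec p[e:=0] F + x • lawVec p[e:=1] F`. -/
theorem lawVec_update (p : E → ℝ) (e : E) (x : ℝ) (F : ι → Set (Config E)) :
    lawVec (Function.update p e x) F =
      (1 - x) • lawVec (Function.update p e 0) F + x • lawVec (Function.update p e 1) F := by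
  funext s
  simp only [lawVec, Pi.add_apply, Pi.smul_apply, smul_eq_mul]
  rw [prob_update]
  ring

/-- The one-edge chord identity for a quadratic form of the law
(`T(π_{p[e:=x]}) = (1 - x) T(π⁰) + x T(π¹) - x (1 - x) T(π¹ - π⁰)`). -/
theorem quadSum_lawVec_update [Fintype ι] (A : ι → ι → ℝ) (p : E → ℝ) (e : E) (x : ℝ)
    (F : ι → Set (Config E)) :
    quadSum A (lawVec (Function.update p e x) F) =
      (1 - x) * quadSum A (lawVec (Function.update p e 0) F)
        + x * quadSum A (lawVec (Function.update p e 1) F)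
        - x * (1 - x) * quadSum A
            (lawVec (Function.update p e 1) F - lawVec (Function.update p e 0) F) := by
  rw [lawVec_update, quadSum_chord]

/-- The same identity at `p` itself (`x = p_e`). -/
theorem quadSum_lawVec_eq [Fintype ι] (A : ι → ι → ℝ) (p : E → ℝ) (e : E)
    (F : ι → Set (Config E)) :
    quadSum A (lawVec p F) =
      (1 - p e) * quadSum A (lawVec (Function.update p e 0) F)
        + p e * quadSum A (lawVec (Function.update p e 1) F)
        - p e * (1 - p e) * quadSum A
            (lawVec (Function.update p e 1) F - lawVec (Function.update p e 0) F) := by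
  have h := quadSum_lawVec_update A p e (p e) F
  rwa [Function.update_eq_self] at h

end Law

end PercRepro
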